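import Literature.AlgebraicGeometry.Hyperkaehler.K3HilbertMukaiLatticeEmbeddingTransitive
import Literature.AlgebraicGeometry.Hyperkaehler.K3HilbertMonodromyIndex
import Literature.Topology.FourManifolds.LatticeFormsPrimitiveEmbeddingUniqueness
import HarnessLib

/-!
# The faithful monodromy invariant `h ↦ [(T(h), ι(h))]` of a class `h ∈ Λ_n = Λ(K3^{[n]})`
# (Apostolov, *Moduli spaces of polarized irreducible symplectic manifolds are not necessarily connected*,
# Ann. Inst. Fourier 64 (2014), §1, Prop. 1.6 = Markman, *[Mar3]*, Lemma 0.4)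

Layer `Literature/AlgebraicGeometry/Hyperkaehler`. Written for lane `lit-hodgefound` (Track 2 foundations; prover seat
`lit-hodgefound-p18`, gen 47, row g47-#11). Sequel of `K3HilbertMukaiLatticeEmbedding.lean` (g47-#8: the stabiliser of a
primitive `ι : Λ_n ↪ Λ̃` in `O(Λ_n)` is `π⁻¹{±1} = {g | ḡ = ±id}`, and exactly these `g` extend to `O(Λ̃)`) and
`K3HilbertMukaiLatticeEmbeddingTransitive.lean` (g47-#9: `ι(Λ_n)^⊥ = ℤv`, `(v, v) = 2n − 2`). THEOREMS ONLY — no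
definition, no named fact, no instance, no notation.

## Source, verbatim (A. Apostolov, Ann. Inst. Fourier 64 (2014); held text `paper:arxiv-1109.0175` pp. 7–8)

"choose a primitive isometric embedding `ι_X : H²(X, ℤ) ↪ Λ̃` in the `O(Λ̃)`-orbit given by Thm 1.2. For a primitive
class `h ∈ H²(X, ℤ)`, of degree `(h, h) = 2d > 0`, let `T(X, h)` denote the saturation in `Λ̃`, of the sublattice spanned
by `ι_X(h)` and `Im(ι_X)^⊥`. `T(X, h)` is a rank 2 positive definite lattice. Denote by `[(T(X, h), ι_X(h))]` the isometry
class of the pair `(T(X, h), ι_X(h))`, i.e. `(T(X, h), ι_X(h)) ∼ (T′, h′)` iff there exists an isometry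
`γ : T(X, h) → T′` such that `γ(ι_X(h)) = h′`. […] Let `Σ_n` be the set of isometry classes of pairs `(T, h)`, consisting
of an even rank 2 positive definite lattice `T` and a positive degree element `h ∈ T` such that `h^⊥ ≅ ⟨2n−2⟩`. […]
`f_X` is called a faithful monodromy invariant function in [Mar2] because it separates orbits for the action of the
monodromy group of `X` on `I(X)`. **Proposition 1.6.** ([Mar3, Lemma 0.4.]) […] Then `f_{X₁}(h₁) = f_{X₂}(h₂)` if and
only if there exists a polarized parallel-transport operator from `(X₁, H₁)` to `(X₂, H₂)`." Printed proof: (⟹) "there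
exists an isometry `γ ∈ O(Λ̃)` such that `γ ∘ ι_{X₁} = ι_{X₂} ∘ g`. `γ` induces an isometry between the pairs"; (⟸)
"`T(X₁, h)` and `T(X₂, h)` are primitively-embedded sublattices of signature `(2, 0)`, of the same isometry class, in the
unimodular lattice `Λ̃`, of signature `(4, 20)`. Therefore, [Nik, Thm. 1.1.2.b)] implies that there exists a
`γ ∈ O(Λ̃)`, such that `γ(T(X₁, h)) = T(X₂, h)`, and `γ(ι_{X₁}(h₁)) = ι_{X₂}(h₂)`. Set `g = ι_{X₂}⁻¹ ∘ γ ∘ ι_{X₁}` […]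
Now assume that `g` is orientation-reversing. Choose `α ∈ H²(X₂, ℤ)` satisfying `(α, α) = 2`, `(α, h₂) = 0`. […]
`ρ_α(h₂) = −h₂`, `g̃` is an orientation-preserving isometry".

## The formalisation (one fixed `X`, i.e. one fixed primitive `ι : L ↪ Λ`; the lattice content of Prop. 1.6)

* `T(h)` is written WITHOUT a definition as the biorthogonal `(ℤ·ι(h) ⊔ ι(L)^⊥)^⊥⊥ ⊂ Λ`, which in the unimodular `Λ`
  is the saturation of `ℤ·ι(h) ⊔ ι(L)^⊥` (§1: same rank, `exists_smul_mem_of_mem_orthogonal_orthogonal`). An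
  "isometry of pairs `(T(h₁), ι h₁) ≅ (T(h₂), ι h₂)`" is an isometric `ℤ`-linear equivalence `e : T(h₁) ≃ T(h₂)` with
  `e(ι h₁) = ι h₂`.
* "monodromy group" / "polarized parallel-transport operator": at the lattice level (Markman's Thm. 1.2 and Lemma 9.2,
  quoted by Apostolov as Thm. 1.2/1.5, identify `Mon²(K3^{[n]})` with the stabiliser of `[ι_X]` in `O⁺`), the group is
  `O⁺(L) ∩ π⁻¹{±1} = {g ∈ O⁺(L) | ḡ = ±id}` — the tree's standing convention (`K3HilbertMonodromyIndex.lean`,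
  `K3HilbertPolarisationTypeTwoComponents.lean`); §2 first treats `π⁻¹{±1}` (pure lattice statement, any symmetric
  unimodular `Λ`, resp. even unimodular with `n₊, n₋ > 2` for the converse), §3 adds `O⁺` for `Λ_n ↪ Λ̃` by Apostolov's
  reflection trick (`σ_α`, `α² = 2`, `α ⊥ h₂`; the tree's `σ_α = −ρ_α` has `σ̄_α = id` and reverses orientation).
* Primitivity of `h` and `(h, h) > 0` are not needed for Prop. 1.6 itself, only `(h, h) ≠ 0`; positivity enters in
  "`T(X, h)` is positive definite" (§1 `apply_pos_of_mem_orthogonal_orthogonal`, §3).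

## Contents (all proved)

§1 (general `Λ` symmetric unimodular on `X`, `ι : L ↪ Λ` injective isometric with `ι(L) = v^⊥`, `ι(L)^⊥ = ℤv`,
`(v, v) ≠ 0`): `T(h)` has rank `2` (`finrank_orthogonal_orthogonal_span_sup_eq_two`), `T(h) ∩ (ι h)^⊥ = ι(L)^⊥ = ℤv`
("`h^⊥ ≅ ⟨2n−2⟩`", `setOf_mem_orthogonal_orthogonal_and_apply_eq_zero_eq`), `T(h)` is positive definite for
`(h, h), (v, v) > 0` (`apply_pos_of_mem_orthogonal_orthogonal`); tools: `finrank_orthogonal_orthogonal`,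
`exists_smul_mem_of_le_of_finrank_le`, `exists_smul_mem_of_mem_orthogonal_orthogonal` (biorthogonal = saturation).
§2 **Prop. 1.6, lattice form**: `exists_pairIsometry_of_exists_isometryEquiv` (⟹: `g ∈ π⁻¹{±1}` with `g h₁ = h₂`
extends to `f ∈ O(Λ)` by g47-#8, and `f` carries `(T(h₁), ι h₁)` onto `(T(h₂), ι h₂)`),
`exists_isometryEquiv_of_pairIsometry` (⟸, `Λ` even unimodular, `n₊, n₋ > 2`: Nikulin's extension
`exists_isometryEquiv_map_eq_of_primitive` of the pair isometry to `φ ∈ O(Λ)`; `φ v = ±v` because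
`T(h₂) ∩ (ι h₂)^⊥ = ℤv`; `g := ι⁻¹ φ ι ∈ π⁻¹{±1}` by g47-#8), and the iff
`exists_isometryEquiv_apply_eq_iff_nonempty_pairIsometry`.
§3 `Λ_n ↪ Λ̃ = E₈(−1)^{⊕2} ⊕ U^{⊕4}`, `n ≥ 2`, any primitive `ι`: `k3HilbertLattice_pairLattice` ("`T(X, h)` is a rank 2
positive definite lattice", `h^⊥ = ℤv ≅ ⟨2n−2⟩`) and **`k3HilbertLattice_exists_isOrientationPreserving_apply_eq_iff_nonempty_pairIsometry`:
`h₁, h₂` (`(h_i, h_i) ≠ 0`) lie in one orbit of `O⁺(Λ_n) ∩ π⁻¹{±1}` iff `(T(h₁), ι h₁) ≅ (T(h₂), ι h₂)`** — the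
invariant is faithful.

## References

* [Apostolov2014NotConnected] A. Apostolov, Moduli spaces of polarized irreducible symplectic manifolds are not
  necessarily connected, Ann. Inst. Fourier 64 (2014) 189–202 (arXiv:1109.0175): §1 (definition of `T(X, h)`, `f_X`,
  `Σ_n`), Prop. 1.6 and its proof.
* [Markman2011Survey] E. Markman, A survey of Torelli and monodromy results (2011): §5.3 (faithful monodromy invariants),
  §9.1.2 Lemma 9.4; Thm. 9.8 (= [Mar3]).
* [Nikulin1980] V. V. Nikulin, Integral symmetric bilinear forms and some of their applications (1980): Thm. 1.1.2,
  Thm. 1.14.4.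
-/

noncomputable section

open Module Function
open LinearMap (BilinForm)
open Literature.Topology.FourManifolds Literature.AlgebraicGeometry.Surfaces

namespace LinearMap.BilinForm

/-! ### §1 `T(h) = (ℤ·ι(h) ⊔ ι(L)^⊥)^⊥⊥`: saturation, rank `2`, `h^⊥ = ℤv`, positivity -/

section Prelim

variable {X : Type*} [AddCommGroup X] [Module.Finite ℤ X] [Module.Free ℤ X] (Λ : BilinForm ℤ X)

omit [Module.Finite ℤ X] [Module.Free ℤ X] in
/-- The elements of `ℤa ⊔ ℤb` are the `p a + q b`. [folklore] -/
private theorem mem_span_singleton_sup_span_singleton_iff {a b x : X} : x ∈ (ℤ ∙ a) ⊔ (ℤ ∙ b) ↔ ∃ p q : ℤ, x = p • a + q • b := by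
  rw [Submodule.mem_sup]
  constructor
  · rintro ⟨y, hy, z, hz, rfl⟩
    obtain ⟨p, rfl⟩ := Submodule.mem_span_singleton.1 hy
    obtain ⟨q, rfl⟩ := Submodule.mem_span_singleton.1 hz
    exact ⟨p, q, rfl⟩
  · rintro ⟨p, q, rfl⟩
    exact ⟨p • a, Submodule.mem_span_singleton.2 ⟨p, rfl⟩, q • b, Submodule.mem_span_singleton.2 ⟨q, rfl⟩, rfl⟩

omit [Module.Finite ℤ X] [Module.Free ℤ X] in
/-- `ℤa ⊔ ℤb` is non-degenerate for `a ⊥ b` with `(a, a), (b, b) ≠ 0` (the Gram matrix is `diag((a,a), (b,b))`).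
[folklore] -/
private theorem nondegenerate_restrict_span_pair (hΛ : Λ.IsSymm) {a b : X} (ha : Λ a a ≠ 0) (hb : Λ b b ≠ 0)
    (hab : Λ a b = 0) : (Λ.restrict ((ℤ ∙ a) ⊔ (ℤ ∙ b))).Nondegenerate := by
  refine (LinearMap.IsRefl.nondegenerate_iff_separatingLeft (hΛ.restrict _).isRefl).2 fun x hx ↦ ?_
  obtain ⟨p, q, hpq⟩ := (mem_span_singleton_sup_span_singleton_iff (x := (x : X))).1 x.2
  have h1 : Λ x a = 0 := hx ⟨a, Submodule.mem_sup_left (Submodule.mem_span_singleton_self a)⟩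
  have h2 : Λ x b = 0 := hx ⟨b, Submodule.mem_sup_right (Submodule.mem_span_singleton_self b)⟩
  rw [hpq] at h1 h2
  simp only [map_add, map_smul, LinearMap.add_apply, LinearMap.smul_apply, smul_eq_mul, hab, hΛ.eq b a,
    mul_zero, add_zero, zero_add, mul_eq_zero] at h1 h2
  have hp : p = 0 := h1.resolve_right ha
  have hq : q = 0 := h2.resolve_right hb
  apply Subtype.ext
  rw [hpq, hp, hq, zero_smul, zero_smul, add_zero]
  rfl

omit [Module.Finite ℤ X] in
/-- `rk (ℤa ⊔ ℤb) = 2` for `a ⊥ b`, `(a, a) ≠ 0`, `b ≠ 0`. [folklore] -/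
private theorem finrank_span_pair (hΛ : Λ.IsSymm) {a b : X} (ha : Λ a a ≠ 0) (hb : b ≠ 0) (hab : Λ a b = 0) :
    finrank ℤ ((ℤ ∙ a) ⊔ (ℤ ∙ b) : Submodule ℤ X) = 2 := by
  have hli : LinearIndependent ℤ ![a, b] := by
    rw [LinearIndependent.pair_iff]
    intro p q hpq
    have h1 := congrArg (fun w ↦ Λ w a) hpq
    simp only [map_add, map_smul, LinearMap.add_apply, LinearMap.smul_apply, smul_eq_mul, hΛ.eq b a, hab, mul_zero,
      add_zero, map_zero, LinearMap.zero_apply, mul_eq_zero] at h1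
    have hp : p = 0 := h1.resolve_right ha
    rw [hp, zero_smul, zero_add] at hpq
    exact ⟨hp, (smul_eq_zero.1 hpq).resolve_right hb⟩
  have h := finrank_span_eq_card hli
  rw [show Set.range ![a, b] = {a, b} by simp [Set.pair_comm], Submodule.span_insert] at h
  simpa using h

/-- **`rk S^⊥⊥ = rk S`** for a non-degenerate sublattice `S` of a unimodular symmetric `Λ` (`rk S + rk S^⊥ = rk Λ`
and, `S^⊥` being primitive, `rk S^⊥ + rk S^⊥⊥ = rk Λ`). [cite: Nikulin1980, §1.1–§1.3 (primitive sublattices and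
orthogonal complements in unimodular lattices)] -/
theorem finrank_orthogonal_orthogonal [Λ.IsPerfPair] (hΛ : Λ.IsSymm) (S : Submodule ℤ X)
    (hS : (Λ.restrict S).Nondegenerate) : finrank ℤ (Λ.orthogonal (Λ.orthogonal S)) = finrank ℤ S := by
  have h1 := Λ.finrank_add_finrank_orthogonal_of_nondegenerate S hΛ hS
  have h2 := Λ.finrank_add_finrank_orthogonal_of_forall_smul_mem (Λ.orthogonal S) hΛ
    fun k x hk hx ↦ Λ.mem_orthogonal_of_smul_mem S hk hx
  omega

omit Λ in
/-- **Sublattices of the same rank differ by torsion**: `L ≤ L'` with `rk L' ≤ rk L` ⟹ every `x ∈ L'` has `k x ∈ L`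
for some `k ≠ 0` (else `x` and a basis of `L` would be `rk L + 1` independent vectors of `L'`). [folklore] -/
private theorem exists_smul_mem_of_le_of_finrank_le {L L' : Submodule ℤ X} (hle : L ≤ L') (hr : finrank ℤ L' ≤ finrank ℤ L)
    {x : X} (hx : x ∈ L') : ∃ k : ℤ, k ≠ 0 ∧ k • x ∈ L := by
  obtain ⟨n, bL⟩ := Module.basisOfFiniteTypeTorsionFree' (R := ℤ) (M := L)
  by_contra hxL
  push Not at hxL
  have key : ∀ (c : ℤ) (y : X), y ∈ Submodule.span ℤ (Set.range fun i ↦ (bL i : X)) →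
      c • x + y = 0 → c = 0 := by
    intro c y hy hc
    by_contra hc0
    refine hxL c hc0 ?_
    rw [eq_neg_of_add_eq_zero_left hc]
    refine neg_mem ((Submodule.span_le.2 ?_) hy)
    rintro _ ⟨i, rfl⟩
    exact (bL i).2
  have hli : LinearIndependent ℤ (Fin.cons x (fun i ↦ (bL i : X)) : Fin (n + 1) → X) :=
    LinearIndependent.finCons' x _ (bL.linearIndependent.map' L.subtype L.ker_subtype) key
  let v : Fin (n + 1) → L' := Fin.cons ⟨x, hx⟩ fun i ↦ ⟨bL i, hle (bL i).2⟩
  have hv : L'.subtype ∘ v = Fin.cons x (fun i ↦ (bL i : X)) := by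
    funext j
    refine Fin.cases ?_ (fun i ↦ ?_) j
    · simp [v]
    · simp [v]
  have hli' : LinearIndependent ℤ v := LinearIndependent.of_comp L'.subtype (hv ▸ hli)
  have h1 := hli'.fintype_card_le_finrank
  rw [Fintype.card_fin] at h1
  have h2 : finrank ℤ L = n := by rw [finrank_eq_card_basis bL, Fintype.card_fin]
  omega

/-- **`S^⊥⊥` is the saturation of `S`** (`S` non-degenerate in a unimodular symmetric `Λ`): every `z ∈ S^⊥⊥` has
`k z ∈ S`, `k ≠ 0` — Apostolov's "the saturation in `Λ̃`, of the sublattice spanned by `ι_X(h)` and `Im(ι_X)^⊥`" is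
the biorthogonal used below. [cite: Apostolov2014NotConnected, §1 (definition of `T(X, h)`)] [cite: Nikulin1980, §1.1] -/
theorem exists_smul_mem_of_mem_orthogonal_orthogonal [Λ.IsPerfPair] (hΛ : Λ.IsSymm) (S : Submodule ℤ X)
    (hS : (Λ.restrict S).Nondegenerate) {z : X} (hz : z ∈ Λ.orthogonal (Λ.orthogonal S)) :
    ∃ k : ℤ, k ≠ 0 ∧ k • z ∈ S :=
  exists_smul_mem_of_le_of_finrank_le (Λ.le_orthogonal_orthogonal hΛ.isRefl)
    (Λ.finrank_orthogonal_orthogonal hΛ S hS).le hz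

end Prelim

section Invariant

variable {X : Type*} [AddCommGroup X] [Module.Finite ℤ X] [Module.Free ℤ X] (Λ : BilinForm ℤ X)
variable {M : Type*} [AddCommGroup M] {L : BilinForm ℤ M}

/-- In `T = (ℤa ⊔ ℤv)^⊥⊥` (`a ⊥ v`, `(a, a), (v, v) ≠ 0`, `v` primitive) the vectors orthogonal to `a` form `ℤv`:
`k z = p a + q v` with `p (a, a) = k (z, a) = 0`. [cite: Apostolov2014NotConnected, §1 ("`h^⊥ ≅ ⟨2n−2⟩`")] -/
theorem mem_span_singleton_of_mem_orthogonal_orthogonal_of_apply_eq_zero [Λ.IsPerfPair] (hΛ : Λ.IsSymm)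
    {a v : X} (ha : Λ a a ≠ 0) (hv : Λ v v ≠ 0) (hav : Λ a v = 0)
    (hprim : ∀ (k : ℤ) (w : X), k ≠ 0 → k • w ∈ ℤ ∙ v → w ∈ ℤ ∙ v) {z : X}
    (hz : z ∈ Λ.orthogonal (Λ.orthogonal ((ℤ ∙ a) ⊔ (ℤ ∙ v)))) (hza : Λ z a = 0) : z ∈ ℤ ∙ v := by
  obtain ⟨k, hk, hkz⟩ := Λ.exists_smul_mem_of_mem_orthogonal_orthogonal hΛ _
    (Λ.nondegenerate_restrict_span_pair hΛ ha hv hav) hz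
  obtain ⟨p, q, hpq⟩ := (mem_span_singleton_sup_span_singleton_iff (x := k • z)).1 hkz
  have h1 := congrArg (fun w ↦ Λ w a) hpq
  simp only [map_add, map_smul, LinearMap.add_apply, LinearMap.smul_apply, smul_eq_mul, hza, mul_zero, hΛ.eq v a, hav,
    add_zero] at h1
  have hp : p = 0 := (mul_eq_zero.1 h1.symm).resolve_right ha
  rw [hp, zero_smul, zero_add] at hpq
  exact hprim k z hk (hpq ▸ Submodule.mem_span_singleton.2 ⟨q, rfl⟩)

/-! ### §2 Prop. 1.6 at the lattice level: `π⁻¹{±1}`-equivalence of `h₁, h₂` ⟺ `(T(h₁), ι h₁) ≅ (T(h₂), ι h₂)` -/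

/-- **Prop. 1.6, "⟸ polarized parallel transport ⟹ equal invariants", lattice form**: if `g ∈ O(L)` acts as `±1`
on `A_L` and `g h₁ = h₂`, then `(T(h₁), ι h₁) ≅ (T(h₂), ι h₂)` — `g` extends to `f ∈ O(Λ)` with `f ∘ ι = ι ∘ g`
(row g47-#8), `f v = ±v`, so `f` maps `ℤ·ι h₁ ⊔ ι(L)^⊥` onto `ℤ·ι h₂ ⊔ ι(L)^⊥` and their biorthogonals onto each
other ("`γ` induces an isometry between the pairs"). `Λ` symmetric unimodular; no parity or signature hypothesis.
[cite: Apostolov2014NotConnected, §1 Prop. 1.6 (proof, first direction)] [cite: Markman2011Survey, §9.1.2 Lemma 9.4] -/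
theorem exists_pairIsometry_of_exists_isometryEquiv [Λ.IsPerfPair] (hΛ : Λ.IsSymm) {ι : M →ₗ[ℤ] X}
    (hinj : Injective ι) (hιC : ∀ x y, Λ (ι x) (ι y) = L x y) {v : X} (hv : Λ v v ≠ 0)
    (hrange : LinearMap.range ι = Λ.orthogonal (ℤ ∙ v)) (hSv : Λ.orthogonal (LinearMap.range ι) = ℤ ∙ v)
    {h₁ h₂ : M} (g : L.IsometryEquiv L)
    (hg : (∀ a, g.discriminantGroupCongr a = a) ∨ (∀ a, g.discriminantGroupCongr a = -a)) (hgh : g h₁ = h₂) :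
    ∃ e : (Λ.orthogonal (Λ.orthogonal ((ℤ ∙ ι h₁) ⊔ Λ.orthogonal (LinearMap.range ι)))) ≃ₗ[ℤ]
        (Λ.orthogonal (Λ.orthogonal ((ℤ ∙ ι h₂) ⊔ Λ.orthogonal (LinearMap.range ι)))),
      (∀ s t, Λ (e s) (e t) = Λ s t) ∧
        ∀ s : Λ.orthogonal (Λ.orthogonal ((ℤ ∙ ι h₁) ⊔ Λ.orthogonal (LinearMap.range ι))),
          (s : X) = ι h₁ → (e s : X) = ι h₂ := by
  obtain ⟨f, hf⟩ := (Λ.exists_isometryEquiv_apply_eq_apply_iff hΛ hinj hιC hv hrange g).2 hg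
  -- `f v = ±v`, so `f (ℤ v) = ℤ v`
  have hnd : Λ.Nondegenerate := Λ.nondegenerate_of_isPerfPair_of_isSymm hΛ
  have hmapr : (Λ.orthogonal (ℤ ∙ v)).map (f.toLinearEquiv : X →ₗ[ℤ] X) = Λ.orthogonal (ℤ ∙ v) := by
    rw [← hrange, ← LinearMap.range_comp]
    have hc : (f.toLinearEquiv : X →ₗ[ℤ] X) ∘ₗ ι = ι ∘ₗ (g.toLinearEquiv : M →ₗ[ℤ] M) := LinearMap.ext fun x ↦ hf x
    rw [hc, LinearMap.range_comp, LinearEquiv.range, Submodule.map_top]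
  have hfv : (ℤ ∙ v).map (f.toLinearEquiv : X →ₗ[ℤ] X) = ℤ ∙ v := by
    have hmap' := hmapr
    rw [map_orthogonal_span_singleton] at hmap'
    rw [Submodule.map_span, Set.image_singleton]
    change ℤ ∙ f v = ℤ ∙ v
    rcases Λ.eq_or_eq_neg_of_orthogonal_span_singleton_eq hnd hΛ hv (f.map_app v v) hmap' with h | h
    · rw [h]
    · rw [h, ← Set.neg_singleton, Submodule.span_neg]
  -- `f` maps `N₁ = ℤ ι h₁ ⊔ (range ι)^⊥` onto `N₂`, hence `T₁` onto `T₂`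
  have hN : ((ℤ ∙ ι h₁) ⊔ Λ.orthogonal (LinearMap.range ι)).map (f.toLinearEquiv : X →ₗ[ℤ] X) =
      (ℤ ∙ ι h₂) ⊔ Λ.orthogonal (LinearMap.range ι) := by
    rw [Submodule.map_sup, hSv, hfv, Submodule.map_span, Set.image_singleton]
    change (ℤ ∙ f (ι h₁)) ⊔ _ = _
    rw [hf, hgh]
  have hT : (Λ.orthogonal (Λ.orthogonal ((ℤ ∙ ι h₁) ⊔ Λ.orthogonal (LinearMap.range ι)))).map
      (f.toLinearEquiv : X →ₗ[ℤ] X) = Λ.orthogonal (Λ.orthogonal ((ℤ ∙ ι h₂) ⊔ Λ.orthogonal (LinearMap.range ι))) := by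
    rw [map_orthogonal_eq_orthogonal_map, map_orthogonal_eq_orthogonal_map, hN]
  refine ⟨f.toLinearEquiv.ofSubmodules _ _ hT, fun s t ↦ f.map_app (t : X) (s : X), fun s hs ↦ ?_⟩
  rw [LinearEquiv.ofSubmodules_apply]
  change f s = ι h₂
  rw [hs, hf, hgh]

omit [Module.Finite ℤ X] [Module.Free ℤ X] in
/-- "Set `g = ι_{X₂}⁻¹ ∘ γ ∘ ι_{X₁}`": an isometry `φ` of `Λ` with `φ(ι(L)) = ι(L)` is `ι ∘ g ∘ ι⁻¹` there for a
(unique) `g ∈ O(L)`. [cite: Apostolov2014NotConnected, §1 Prop. 1.6 (proof)] -/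
theorem exists_isometryEquiv_comp_eq_of_map_range_eq {ι : M →ₗ[ℤ] X} (hinj : Injective ι)
    (hιC : ∀ x y, Λ (ι x) (ι y) = L x y) (φ : Λ.IsometryEquiv Λ)
    (hmap : (LinearMap.range ι).map (φ.toLinearEquiv : X →ₗ[ℤ] X) = LinearMap.range ι) :
    ∃ g : L.IsometryEquiv L, ∀ x, φ (ι x) = ι (g x) := by
  obtain ⟨e, he⟩ := Λ.exists_isometryEquiv_restrict_of_range_eq hinj hιC rfl
  let F : (Λ.restrict (LinearMap.range ι)).IsometryEquiv (Λ.restrict (LinearMap.range ι)) :=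
    { φ.toLinearEquiv.ofSubmodules _ _ hmap with
      map_app' := fun p q ↦ φ.map_app (q : X) (p : X) }
  have hF : ∀ p : LinearMap.range ι, (F p : X) = φ p := fun p ↦ rfl
  refine ⟨e.trans (F.trans e.symm), fun x ↦ ?_⟩
  rw [IsometryEquiv.trans_apply, IsometryEquiv.trans_apply, ← he (e.symm (F (e x))), IsometryEquiv.apply_symm_apply,
    hF, he]

omit [Module.Finite ℤ X] [Module.Free ℤ X] in
/-- `ι(h) ⊥ v` when `ι(L) = v^⊥`. [folklore] -/
private theorem apply_eq_zero_of_range_eq_orthogonal (hΛ : Λ.IsSymm) {ι : M →ₗ[ℤ] X} {v : X}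
    (hrange : LinearMap.range ι = Λ.orthogonal (ℤ ∙ v)) (h : M) : Λ (ι h) v = 0 := by
  have hm : ι h ∈ Λ.orthogonal (ℤ ∙ v) := hrange ▸ LinearMap.mem_range_self ι h
  rw [mem_orthogonal_iff] at hm
  rw [hΛ.eq]
  exact hm v (Submodule.mem_span_singleton_self v)

/-- **"`T(X, h)` is a rank 2 lattice"**: `rk (ℤ·ι h ⊔ ℤv)^⊥⊥ = rk (ℤ·ι h ⊔ ℤv) = 2` (`(h, h) ≠ 0`, `(v, v) ≠ 0`,
`ι h ⊥ v`). [cite: Apostolov2014NotConnected, §1 ("`T(X, h)` is a rank 2 positive definite lattice")] -/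
theorem finrank_orthogonal_orthogonal_span_sup_eq_two [Λ.IsPerfPair] (hΛ : Λ.IsSymm) {ι : M →ₗ[ℤ] X}
    (hιC : ∀ x y, Λ (ι x) (ι y) = L x y) {v : X} (hv : Λ v v ≠ 0)
    (hrange : LinearMap.range ι = Λ.orthogonal (ℤ ∙ v)) (hSv : Λ.orthogonal (LinearMap.range ι) = ℤ ∙ v)
    {h : M} (hh : L h h ≠ 0) :
    finrank ℤ (Λ.orthogonal (Λ.orthogonal ((ℤ ∙ ι h) ⊔ Λ.orthogonal (LinearMap.range ι)))) = 2 := by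
  have hιh : Λ (ι h) (ι h) ≠ 0 := by rwa [hιC]
  have hιv : Λ (ι h) v = 0 := Λ.apply_eq_zero_of_range_eq_orthogonal hΛ hrange h
  have hv0 : v ≠ 0 := by rintro rfl; exact hv (by simp)
  rw [hSv, Λ.finrank_orthogonal_orthogonal hΛ _ (Λ.nondegenerate_restrict_span_pair hΛ hιh hv hιv),
    Λ.finrank_span_pair hΛ hιh hv0 hιv]

/-- **Prop. 1.6, "equal invariants ⟹ ∃ `g`", lattice form** (`Λ` even unimodular with `n₊(Λ), n₋(Λ) > 2`;
`(h_i, h_i) ≠ 0`): an isometry of pairs `e : (T(h₁), ι h₁) ≅ (T(h₂), ι h₂)` yields `g ∈ O(L)` with `ḡ = ±id` and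
`g h₁ = h₂`. Printed proof, followed: `T(h_i)` are primitive of rank `2 < n₊, n₋`, so `e` extends to `φ ∈ O(Λ)` with
`φ(T(h₁)) = T(h₂)` ("[Nik, Thm. 1.1.2.b)]" — the tree's `exists_isometryEquiv_map_eq_of_primitive`); `φ(ι h₁) = ι h₂`;
`φ v ∈ T(h₂) ∩ (ι h₂)^⊥ = ℤv` has `(φ v)² = v²`, so `φ v = ±v` and `φ(ι(L)) = φ(v^⊥) = v^⊥ = ι(L)`
("`γ(ι_{X₁}(H²)^⊥) = ι_{X₂}(H²)^⊥`"); `g := ι⁻¹ φ ι` has `g h₁ = h₂`, and `ḡ = ±id` by row g47-#8.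
[cite: Apostolov2014NotConnected, §1 Prop. 1.6 (proof, second direction)] [cite: Nikulin1980, Thm. 1.14.4 / Thm. 1.1.2] -/
theorem exists_isometryEquiv_of_pairIsometry [Λ.IsPerfPair] (hΛ : Λ.IsSymm) (hu : Λ.IsUnimodular) (he : Λ.IsEven)
    (h4 : 2 < sigPos Λ.toQuadraticMap) (h20 : 2 < sigNeg Λ.toQuadraticMap) {ι : M →ₗ[ℤ] X} (hinj : Injective ι)
    (hιC : ∀ x y, Λ (ι x) (ι y) = L x y) {v : X} (hv : Λ v v ≠ 0)
    (hrange : LinearMap.range ι = Λ.orthogonal (ℤ ∙ v)) (hSv : Λ.orthogonal (LinearMap.range ι) = ℤ ∙ v)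
    (hprim : ∀ (k : ℤ) (w : X), k ≠ 0 → k • w ∈ ℤ ∙ v → w ∈ ℤ ∙ v) {h₁ h₂ : M} (hh₁ : L h₁ h₁ ≠ 0)
    (hh₂ : L h₂ h₂ ≠ 0)
    (e : (Λ.orthogonal (Λ.orthogonal ((ℤ ∙ ι h₁) ⊔ Λ.orthogonal (LinearMap.range ι)))) ≃ₗ[ℤ]
        (Λ.orthogonal (Λ.orthogonal ((ℤ ∙ ι h₂) ⊔ Λ.orthogonal (LinearMap.range ι)))))
    (heC : ∀ s t, Λ (e s) (e t) = Λ s t)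
    (heh : ∀ s : Λ.orthogonal (Λ.orthogonal ((ℤ ∙ ι h₁) ⊔ Λ.orthogonal (LinearMap.range ι))),
          (s : X) = ι h₁ → (e s : X) = ι h₂) :
    ∃ g : L.IsometryEquiv L, ((∀ a, g.discriminantGroupCongr a = a) ∨ (∀ a, g.discriminantGroupCongr a = -a)) ∧
      g h₁ = h₂ := by
  have hnd : Λ.Nondegenerate := Λ.nondegenerate_of_isPerfPair_of_isSymm hΛ
  have hsat : ∀ (N : Submodule ℤ X) (c : ℤ) (z : X), c ≠ 0 → c • z ∈ Λ.orthogonal N → z ∈ Λ.orthogonal N :=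
    fun N c z hc hz ↦ Λ.mem_orthogonal_of_smul_mem N hc hz
  have hT₁ := Λ.finrank_orthogonal_orthogonal_span_sup_eq_two hΛ hιC hv hrange hSv hh₁
  -- Nikulin: the pair isometry extends to `φ ∈ O(Λ)`
  obtain ⟨φ, hφe, hφT⟩ := exists_isometryEquiv_map_eq_of_primitive Λ hΛ hu he (hsat _) (hsat _)
    (by rw [hT₁]; exact h4) (by rw [hT₁]; exact h20) e heC
  have hmem₁ : ι h₁ ∈ Λ.orthogonal (Λ.orthogonal ((ℤ ∙ ι h₁) ⊔ Λ.orthogonal (LinearMap.range ι))) :=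
    Λ.le_orthogonal_orthogonal hΛ.isRefl (Submodule.mem_sup_left (Submodule.mem_span_singleton_self _))
  have hφh : φ (ι h₁) = ι h₂ := by
    have h := hφe ⟨ι h₁, hmem₁⟩
    exact h.trans (heh _ rfl)
  -- `φ v ∈ T(h₂) ∩ (ι h₂)^⊥ = ℤ v`
  have hvT : v ∈ Λ.orthogonal (Λ.orthogonal ((ℤ ∙ ι h₁) ⊔ Λ.orthogonal (LinearMap.range ι))) := by
    refine Λ.le_orthogonal_orthogonal hΛ.isRefl (Submodule.mem_sup_right ?_)
    rw [hSv]
    exact Submodule.mem_span_singleton_self v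
  have hφv : φ v ∈ Λ.orthogonal (Λ.orthogonal ((ℤ ∙ ι h₂) ⊔ (ℤ ∙ v))) := by
    rw [← hSv, ← hφT]
    exact ⟨v, hvT, rfl⟩
  have hφva : Λ (φ v) (ι h₂) = 0 := by
    rw [← hφh, φ.map_app, hΛ.eq]
    exact Λ.apply_eq_zero_of_range_eq_orthogonal hΛ hrange h₁
  have hιh₂ : Λ (ι h₂) (ι h₂) ≠ 0 := by rwa [hιC]
  obtain ⟨c, hc⟩ := Submodule.mem_span_singleton.1
    (Λ.mem_span_singleton_of_mem_orthogonal_orthogonal_of_apply_eq_zero hΛ hιh₂ hv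
      (Λ.apply_eq_zero_of_range_eq_orthogonal hΛ hrange h₂) hprim hφv hφva)
  -- `c = ±1`
  have hcc : c * c = 1 := by
    have h := φ.map_app v v
    rw [← hc] at h
    simp only [map_smul, LinearMap.smul_apply, smul_eq_mul] at h
    have h' : (c * c - 1) * Λ v v = 0 := by linear_combination h
    have := (mul_eq_zero.1 h').resolve_right hv
    linear_combination this
  -- `φ` preserves `v^⊥ = ι(M)`
  have hmapr : (LinearMap.range ι).map (φ.toLinearEquiv : X →ₗ[ℤ] X) = LinearMap.range ι := by
    rw [hrange, map_orthogonal_span_singleton]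
    change Λ.orthogonal (ℤ ∙ φ v) = _
    rw [← hc]
    rcases Int.isUnit_iff.1 (IsUnit.of_mul_eq_one c hcc) with h | h
    · rw [h, one_smul]
    · rw [h, neg_one_smul, ← Set.neg_singleton, Submodule.span_neg]
  obtain ⟨g, hg⟩ := Λ.exists_isometryEquiv_comp_eq_of_map_range_eq hinj hιC φ hmapr
  refine ⟨g, (Λ.exists_isometryEquiv_apply_eq_apply_iff hΛ hinj hιC hv hrange g).1 ⟨φ, hg⟩, hinj ?_⟩
  rw [← hg, hφh]

/-- **"`h^⊥ ≅ ⟨2n−2⟩`" inside `T(X, h)`**: the vectors of `T(h)` orthogonal to `ι h` are exactly `ι(L)^⊥ = ℤv`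
(`(h, h) ≠ 0`). [cite: Apostolov2014NotConnected, §1 (definition of `Σ_n`: "`h^⊥ ≅ ⟨2n−2⟩`")] -/
theorem setOf_mem_orthogonal_orthogonal_and_apply_eq_zero_eq [Λ.IsPerfPair] (hΛ : Λ.IsSymm) {ι : M →ₗ[ℤ] X}
    (hιC : ∀ x y, Λ (ι x) (ι y) = L x y) {v : X} (hv : Λ v v ≠ 0)
    (hrange : LinearMap.range ι = Λ.orthogonal (ℤ ∙ v)) (hSv : Λ.orthogonal (LinearMap.range ι) = ℤ ∙ v)
    (hprim : ∀ (k : ℤ) (w : X), k ≠ 0 → k • w ∈ ℤ ∙ v → w ∈ ℤ ∙ v) {h : M} (hh : L h h ≠ 0) :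
    {z | z ∈ Λ.orthogonal (Λ.orthogonal ((ℤ ∙ ι h) ⊔ Λ.orthogonal (LinearMap.range ι))) ∧ Λ z (ι h) = 0} =
      Λ.orthogonal (LinearMap.range ι) := by
  have hιh : Λ (ι h) (ι h) ≠ 0 := by rwa [hιC]
  ext z
  simp only [Set.mem_setOf_eq, SetLike.mem_coe]
  rw [hSv]
  refine ⟨fun hz ↦ Λ.mem_span_singleton_of_mem_orthogonal_orthogonal_of_apply_eq_zero hΛ hιh hv
    (Λ.apply_eq_zero_of_range_eq_orthogonal hΛ hrange h) hprim hz.1 hz.2, fun hz ↦ ⟨?_, ?_⟩⟩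
  · exact Λ.le_orthogonal_orthogonal hΛ.isRefl (Submodule.mem_sup_right hz)
  · obtain ⟨c, rfl⟩ := Submodule.mem_span_singleton.1 hz
    rw [map_smul, LinearMap.smul_apply, hΛ.eq, Λ.apply_eq_zero_of_range_eq_orthogonal hΛ hrange h, smul_zero]

/-- **"`T(X, h)` is positive definite"** when `(h, h) > 0` and `(v, v) > 0`: for `z ∈ T(h)`, `k z = p·ι h + q v`
with `k ≠ 0` and `k² (z, z) = p² (h, h) + q² (v, v)`. [cite: Apostolov2014NotConnected, §1 ("`T(X, h)` is a rank 2
positive definite lattice")] -/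
theorem apply_pos_of_mem_orthogonal_orthogonal [Λ.IsPerfPair] (hΛ : Λ.IsSymm) {ι : M →ₗ[ℤ] X}
    (hιC : ∀ x y, Λ (ι x) (ι y) = L x y) {v : X} (hv : 0 < Λ v v)
    (hrange : LinearMap.range ι = Λ.orthogonal (ℤ ∙ v)) (hSv : Λ.orthogonal (LinearMap.range ι) = ℤ ∙ v)
    {h : M} (hh : 0 < L h h) {z : X}
    (hz : z ∈ Λ.orthogonal (Λ.orthogonal ((ℤ ∙ ι h) ⊔ Λ.orthogonal (LinearMap.range ι)))) (hz0 : z ≠ 0) :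
    0 < Λ z z := by
  have hιh : 0 < Λ (ι h) (ι h) := by rwa [hιC]
  have hιv : Λ (ι h) v = 0 := Λ.apply_eq_zero_of_range_eq_orthogonal hΛ hrange h
  rw [hSv] at hz
  obtain ⟨k, hk, hkz⟩ := Λ.exists_smul_mem_of_mem_orthogonal_orthogonal hΛ _
    (Λ.nondegenerate_restrict_span_pair hΛ hιh.ne' hv.ne' hιv) hz
  obtain ⟨p, q, hpq⟩ := (mem_span_singleton_sup_span_singleton_iff (x := k • z)).1 hkz
  have hkk : Λ (k • z) (k • z) = p * p * Λ (ι h) (ι h) + q * q * Λ v v := by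
    rw [hpq]
    simp only [map_add, map_smul, LinearMap.add_apply, LinearMap.smul_apply, smul_eq_mul, hιv, hΛ.eq v (ι h),
      mul_zero, add_zero, zero_add]
    ring
  simp only [map_smul, LinearMap.smul_apply, smul_eq_mul] at hkk
  -- `k² (z,z) = p² (ιh)² + q² v² ≥ 0`, and `= 0` forces `p = q = 0`, `k z = 0`, `z = 0`
  by_contra hneg
  push Not at hneg
  have hk2 : 0 < k * k := by rcases lt_or_gt_of_ne hk with h | h <;> nlinarith
  have hsum : p * p * Λ (ι h) (ι h) + q * q * Λ v v ≤ 0 := by rw [← hkk]; nlinarith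
  have hp : p = 0 := by nlinarith [mul_self_nonneg p, mul_self_nonneg q]
  have hq : q = 0 := by nlinarith [mul_self_nonneg p, mul_self_nonneg q]
  rw [hp, hq, zero_smul, zero_smul, add_zero] at hpq
  exact hz0 ((smul_eq_zero.1 hpq).resolve_left hk)

/-- **Prop. 1.6 at the lattice level** (`Λ` even unimodular, `n₊, n₋ > 2`; `ι : L ↪ Λ` injective isometric with
`ι(L) = v^⊥`, `ι(L)^⊥ = ℤv`, `v` primitive, `(v, v) ≠ 0`; `(h_i, h_i) ≠ 0`): **`h₂ = g h₁` for some `g ∈ O(L)` with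
`ḡ = ±id` iff the pairs `(T(h₁), ι h₁)`, `(T(h₂), ι h₂)` are isometric.**
[cite: Apostolov2014NotConnected, §1 Prop. 1.6 (= [Mar3, Lemma 0.4])] [cite: Markman2011Survey, §5.3] -/
theorem exists_isometryEquiv_apply_eq_iff_nonempty_pairIsometry [Λ.IsPerfPair] (hΛ : Λ.IsSymm)
    (hu : Λ.IsUnimodular) (he : Λ.IsEven) (h4 : 2 < sigPos Λ.toQuadraticMap) (h20 : 2 < sigNeg Λ.toQuadraticMap)
    {ι : M →ₗ[ℤ] X} (hinj : Injective ι) (hιC : ∀ x y, Λ (ι x) (ι y) = L x y) {v : X} (hv : Λ v v ≠ 0)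
    (hrange : LinearMap.range ι = Λ.orthogonal (ℤ ∙ v)) (hSv : Λ.orthogonal (LinearMap.range ι) = ℤ ∙ v)
    (hprim : ∀ (k : ℤ) (w : X), k ≠ 0 → k • w ∈ ℤ ∙ v → w ∈ ℤ ∙ v) {h₁ h₂ : M} (hh₁ : L h₁ h₁ ≠ 0)
    (hh₂ : L h₂ h₂ ≠ 0) :
    (∃ g : L.IsometryEquiv L, ((∀ a, g.discriminantGroupCongr a = a) ∨ (∀ a, g.discriminantGroupCongr a = -a)) ∧
        g h₁ = h₂) ↔
      ∃ e : (Λ.orthogonal (Λ.orthogonal ((ℤ ∙ ι h₁) ⊔ Λ.orthogonal (LinearMap.range ι)))) ≃ₗ[ℤ]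
          (Λ.orthogonal (Λ.orthogonal ((ℤ ∙ ι h₂) ⊔ Λ.orthogonal (LinearMap.range ι)))),
        (∀ s t, Λ (e s) (e t) = Λ s t) ∧
          ∀ s : Λ.orthogonal (Λ.orthogonal ((ℤ ∙ ι h₁) ⊔ Λ.orthogonal (LinearMap.range ι))),
            (s : X) = ι h₁ → (e s : X) = ι h₂ :=
  ⟨fun ⟨g, hg, hgh⟩ ↦ Λ.exists_pairIsometry_of_exists_isometryEquiv hΛ hinj hιC hv hrange hSv g hg hgh,
    fun ⟨e, heC, heh⟩ ↦ Λ.exists_isometryEquiv_of_pairIsometry hΛ hu he h4 h20 hinj hιC hv hrange hSv hprim hh₁ hh₂ e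
      heC heh⟩

end Invariant

end LinearMap.BilinForm

namespace Literature.AlgebraicGeometry.Hyperkaehler

open Literature.Topology.FourManifolds Literature.AlgebraicGeometry.Surfaces LinearMap.BilinForm

/-! ### §3 `Λ_n ↪ Λ̃`: `T(X, h)` and the faithfulness of `h ↦ [(T(h), ι h)]` -/

/-- **"`T(X, h)` is a rank 2 positive definite lattice" with `h^⊥ ≅ ⟨2n−2⟩`**, for any primitive isometric
`ι : Λ_n ↪ Λ̃` (`n ≥ 2`) and `h ∈ Λ_n` with `(h, h) > 0`, `T(h) = (ℤ·ι h ⊔ ι(Λ_n)^⊥)^⊥⊥`: `T(h)` is primitive of rank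
`2`, contains `ι h` and `ι(Λ_n)^⊥`, is positive definite, and its vectors orthogonal to `ι h` form `ι(Λ_n)^⊥ = ℤv` with
`(v, v) = 2n − 2`. [cite: Apostolov2014NotConnected, §1 (definition of `T(X, h)` and of `Σ_n`)] -/
theorem k3HilbertLattice_pairLattice {n : ℕ} (hn : 2 ≤ n)
    {ι : (K3HilbertIndex → ℤ) →ₗ[ℤ] (Fin 2 → Fin 8 → ℤ) × ((Fin 4 → ℤ) × (Fin 4 → ℤ))} (hinj : Function.Injective ι)
    (hιC : ∀ x y, ((LinearMap.BilinForm.pi fun _ : Fin 2 ↦ -e8Form).prod (hyperbolicSum 4)) (ι x) (ι y) =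
      Matrix.toBilin' (k3HilbertGram n) x y)
    (hsat : ∀ (k : ℤ) z, k ≠ 0 → k • z ∈ LinearMap.range ι → z ∈ LinearMap.range ι)
    {h : K3HilbertIndex → ℤ} (hh : 0 < Matrix.toBilin' (k3HilbertGram n) h h) :
    finrank ℤ (((LinearMap.BilinForm.pi fun _ : Fin 2 ↦ -e8Form).prod (hyperbolicSum 4)).orthogonal
        (((LinearMap.BilinForm.pi fun _ : Fin 2 ↦ -e8Form).prod (hyperbolicSum 4)).orthogonal
          ((ℤ ∙ ι h) ⊔ ((LinearMap.BilinForm.pi fun _ : Fin 2 ↦ -e8Form).prod (hyperbolicSum 4)).orthogonal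
            (LinearMap.range ι)))) = 2 ∧
      (∀ (k : ℤ) z, k ≠ 0 →
        k • z ∈ ((LinearMap.BilinForm.pi fun _ : Fin 2 ↦ -e8Form).prod (hyperbolicSum 4)).orthogonal
          (((LinearMap.BilinForm.pi fun _ : Fin 2 ↦ -e8Form).prod (hyperbolicSum 4)).orthogonal
            ((ℤ ∙ ι h) ⊔ ((LinearMap.BilinForm.pi fun _ : Fin 2 ↦ -e8Form).prod (hyperbolicSum 4)).orthogonal
              (LinearMap.range ι))) →
        z ∈ ((LinearMap.BilinForm.pi fun _ : Fin 2 ↦ -e8Form).prod (hyperbolicSum 4)).orthogonal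
          (((LinearMap.BilinForm.pi fun _ : Fin 2 ↦ -e8Form).prod (hyperbolicSum 4)).orthogonal
            ((ℤ ∙ ι h) ⊔ ((LinearMap.BilinForm.pi fun _ : Fin 2 ↦ -e8Form).prod (hyperbolicSum 4)).orthogonal
              (LinearMap.range ι)))) ∧
      ι h ∈ ((LinearMap.BilinForm.pi fun _ : Fin 2 ↦ -e8Form).prod (hyperbolicSum 4)).orthogonal
          (((LinearMap.BilinForm.pi fun _ : Fin 2 ↦ -e8Form).prod (hyperbolicSum 4)).orthogonal
            ((ℤ ∙ ι h) ⊔ ((LinearMap.BilinForm.pi fun _ : Fin 2 ↦ -e8Form).prod (hyperbolicSum 4)).orthogonal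
              (LinearMap.range ι))) ∧
      ((LinearMap.BilinForm.pi fun _ : Fin 2 ↦ -e8Form).prod (hyperbolicSum 4)).orthogonal (LinearMap.range ι) ≤
          ((LinearMap.BilinForm.pi fun _ : Fin 2 ↦ -e8Form).prod (hyperbolicSum 4)).orthogonal
            (((LinearMap.BilinForm.pi fun _ : Fin 2 ↦ -e8Form).prod (hyperbolicSum 4)).orthogonal
              ((ℤ ∙ ι h) ⊔ ((LinearMap.BilinForm.pi fun _ : Fin 2 ↦ -e8Form).prod (hyperbolicSum 4)).orthogonal
                (LinearMap.range ι))) ∧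
      (∀ z ∈ ((LinearMap.BilinForm.pi fun _ : Fin 2 ↦ -e8Form).prod (hyperbolicSum 4)).orthogonal
          (((LinearMap.BilinForm.pi fun _ : Fin 2 ↦ -e8Form).prod (hyperbolicSum 4)).orthogonal
            ((ℤ ∙ ι h) ⊔ ((LinearMap.BilinForm.pi fun _ : Fin 2 ↦ -e8Form).prod (hyperbolicSum 4)).orthogonal
              (LinearMap.range ι))), z ≠ 0 →
        0 < ((LinearMap.BilinForm.pi fun _ : Fin 2 ↦ -e8Form).prod (hyperbolicSum 4)) z z) ∧
      ∃ v : (Fin 2 → Fin 8 → ℤ) × ((Fin 4 → ℤ) × (Fin 4 → ℤ)),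
        {z | z ∈ ((LinearMap.BilinForm.pi fun _ : Fin 2 ↦ -e8Form).prod (hyperbolicSum 4)).orthogonal
            (((LinearMap.BilinForm.pi fun _ : Fin 2 ↦ -e8Form).prod (hyperbolicSum 4)).orthogonal
              ((ℤ ∙ ι h) ⊔ ((LinearMap.BilinForm.pi fun _ : Fin 2 ↦ -e8Form).prod (hyperbolicSum 4)).orthogonal
                (LinearMap.range ι))) ∧
            ((LinearMap.BilinForm.pi fun _ : Fin 2 ↦ -e8Form).prod (hyperbolicSum 4)) z (ι h) = 0} = ℤ ∙ v ∧
        ((LinearMap.BilinForm.pi fun _ : Fin 2 ↦ -e8Form).prod (hyperbolicSum 4)) v v = 2 * (n - 1 : ℕ) := by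
  obtain ⟨hs, -, hu⟩ := isSymm_isEven_isUnimodular_pi_neg_e8Form_prod_hyperbolicSum' 2 4
  haveI : ((LinearMap.BilinForm.pi fun _ : Fin 2 ↦ -e8Form).prod (hyperbolicSum 4)).IsPerfPair := hu
  obtain ⟨v, hprim, hrange, hSv, hvv⟩ := k3HilbertLattice_exists_range_eq_orthogonal_of_saturated hn hinj hιC hsat
  have hv : 0 < ((LinearMap.BilinForm.pi fun _ : Fin 2 ↦ -e8Form).prod (hyperbolicSum 4)) v v := by
    rw [hvv]; omega
  refine ⟨finrank_orthogonal_orthogonal_span_sup_eq_two _ hs hιC hv.ne' hrange hSv hh.ne',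
    fun k z hk hz ↦ mem_orthogonal_of_smul_mem _ _ hk hz,
    LinearMap.BilinForm.le_orthogonal_orthogonal hs.isRefl
      (Submodule.mem_sup_left (Submodule.mem_span_singleton_self _)),
    fun z hz ↦ LinearMap.BilinForm.le_orthogonal_orthogonal hs.isRefl (Submodule.mem_sup_right hz),
    fun z hz hz0 ↦ apply_pos_of_mem_orthogonal_orthogonal _ hs hιC hv hrange hSv hh hz hz0, v, ?_, hvv⟩
  rw [setOf_mem_orthogonal_orthogonal_and_apply_eq_zero_eq _ hs hιC hv.ne' hrange hSv hprim hh.ne', hSv]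

/-- **Apostolov's Prop. 1.6 / Markman's Lemma 0.4 for `Λ_n = Λ(K3^{[n]}) ↪ Λ̃`, `n ≥ 2` — the monodromy invariant
`h ↦ [(T(h), ι(h))]` is faithful**: for any primitive isometric `ι : Λ_n ↪ Λ̃ = E₈(−1)^{⊕2} ⊕ U^{⊕4}` and classes
`h₁, h₂ ∈ Λ_n` with `(h_i, h_i) ≠ 0`, there is `g ∈ O⁺(Λ_n)` acting as `±1` on `A_{Λ_n}` (the lattice group
`Mon² = O⁺(Λ_n) ∩ π⁻¹{±1}`) with `g h₁ = h₂` **iff** the pairs `(T(h₁), ι h₁)` and `(T(h₂), ι h₂)` are isometric,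
`T(h) = (ℤ·ι h ⊔ ι(Λ_n)^⊥)^⊥⊥` the saturation of `⟨ι h⟩ ⊕ ι(Λ_n)^⊥`. The orientation is fixed as printed: "Choose
`α ∈ H²(X₂, ℤ)` satisfying `(α, α) = 2`, `(α, h₂) = 0`" (from two hyperbolic planes of `Λ_n`) and compose with the
reflection `σ_α` (`σ_α h₂ = h₂`, `σ̄_α = id`, `σ_α ∉ O⁺`).
[cite: Apostolov2014NotConnected, §1 Prop. 1.6 and proof ("`f_X` is called a faithful monodromy invariant")] [cite: Markman2011Survey, §5.3 and §9.1.2 Lemma 9.4] -/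
theorem k3HilbertLattice_exists_isOrientationPreserving_apply_eq_iff_nonempty_pairIsometry {n : ℕ} (hn : 2 ≤ n)
    {ι : (K3HilbertIndex → ℤ) →ₗ[ℤ] (Fin 2 → Fin 8 → ℤ) × ((Fin 4 → ℤ) × (Fin 4 → ℤ))} (hinj : Function.Injective ι)
    (hιC : ∀ x y, ((LinearMap.BilinForm.pi fun _ : Fin 2 ↦ -e8Form).prod (hyperbolicSum 4)) (ι x) (ι y) =
      Matrix.toBilin' (k3HilbertGram n) x y)
    (hsat : ∀ (k : ℤ) z, k ≠ 0 → k • z ∈ LinearMap.range ι → z ∈ LinearMap.range ι)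
    {h₁ h₂ : K3HilbertIndex → ℤ} (hh₁ : Matrix.toBilin' (k3HilbertGram n) h₁ h₁ ≠ 0)
    (hh₂ : Matrix.toBilin' (k3HilbertGram n) h₂ h₂ ≠ 0) :
    (∃ g : (Matrix.toBilin' (k3HilbertGram n)).IsometryEquiv (Matrix.toBilin' (k3HilbertGram n)),
        g.IsOrientationPreserving ∧
        ((∀ a, g.discriminantGroupCongr a = a) ∨ (∀ a, g.discriminantGroupCongr a = -a)) ∧ g h₁ = h₂) ↔
      ∃ e : (((LinearMap.BilinForm.pi fun _ : Fin 2 ↦ -e8Form).prod (hyperbolicSum 4)).orthogonal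
            (((LinearMap.BilinForm.pi fun _ : Fin 2 ↦ -e8Form).prod (hyperbolicSum 4)).orthogonal
              ((ℤ ∙ ι h₁) ⊔ ((LinearMap.BilinForm.pi fun _ : Fin 2 ↦ -e8Form).prod (hyperbolicSum 4)).orthogonal
                (LinearMap.range ι)))) ≃ₗ[ℤ]
          (((LinearMap.BilinForm.pi fun _ : Fin 2 ↦ -e8Form).prod (hyperbolicSum 4)).orthogonal
            (((LinearMap.BilinForm.pi fun _ : Fin 2 ↦ -e8Form).prod (hyperbolicSum 4)).orthogonal
              ((ℤ ∙ ι h₂) ⊔ ((LinearMap.BilinForm.pi fun _ : Fin 2 ↦ -e8Form).prod (hyperbolicSum 4)).orthogonal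
                (LinearMap.range ι)))),
        (∀ s t, ((LinearMap.BilinForm.pi fun _ : Fin 2 ↦ -e8Form).prod (hyperbolicSum 4)) (e s) (e t) =
            ((LinearMap.BilinForm.pi fun _ : Fin 2 ↦ -e8Form).prod (hyperbolicSum 4)) s t) ∧
          ∀ s : ((LinearMap.BilinForm.pi fun _ : Fin 2 ↦ -e8Form).prod (hyperbolicSum 4)).orthogonal
              (((LinearMap.BilinForm.pi fun _ : Fin 2 ↦ -e8Form).prod (hyperbolicSum 4)).orthogonal
                ((ℤ ∙ ι h₁) ⊔ ((LinearMap.BilinForm.pi fun _ : Fin 2 ↦ -e8Form).prod (hyperbolicSum 4)).orthogonal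
                  (LinearMap.range ι))),
            (s : (Fin 2 → Fin 8 → ℤ) × ((Fin 4 → ℤ) × (Fin 4 → ℤ))) = ι h₁ →
              (e s : (Fin 2 → Fin 8 → ℤ) × ((Fin 4 → ℤ) × (Fin 4 → ℤ))) = ι h₂ := by
  obtain ⟨hs, hev, hu⟩ := isSymm_isEven_isUnimodular_pi_neg_e8Form_prod_hyperbolicSum' 2 4
  obtain ⟨hp, hng⟩ := sigPos_sigNeg_pi_neg_e8Form_prod_hyperbolicSum 2 4
  haveI : ((LinearMap.BilinForm.pi fun _ : Fin 2 ↦ -e8Form).prod (hyperbolicSum 4)).IsPerfPair := hu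
  obtain ⟨v, hprim, hrange, hSv, hvv⟩ := k3HilbertLattice_exists_range_eq_orthogonal_of_saturated hn hinj hιC hsat
  have hv : ((LinearMap.BilinForm.pi fun _ : Fin 2 ↦ -e8Form).prod (hyperbolicSum 4)) v v ≠ 0 := by
    rw [hvv]; omega
  have hLs := isSymm_toBilin'_k3HilbertGram n
  have hL := nondegenerate_toBilin'_k3HilbertGram hn
  rw [← exists_isometryEquiv_apply_eq_iff_nonempty_pairIsometry _ hs hu hev (by rw [hp]; norm_num)
    (by rw [hng]; norm_num) hinj hιC hv hrange hSv hprim hh₁ hh₂]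
  refine ⟨fun ⟨g, _, hg, hgh⟩ ↦ ⟨g, hg, hgh⟩, fun ⟨g, hg, hgh⟩ ↦ ?_⟩
  by_cases hgo : g.IsOrientationPreserving
  · exact ⟨g, hgo, hg, hgh⟩
  -- fix the orientation with the reflection `σ_u`, `u² = 2`, `u ⊥ h₂`
  obtain ⟨x, y, x₁, y₁, hP⟩ := exists_twoHyperbolicPairs_toBilin'_k3HilbertGram (n := n) (by omega)
  obtain ⟨u, huu, huh⟩ := hP.exists_apply_self_eq_two_apply_eq_zero h₂
  have hσ := isOrientationPreserving_normTwoReflectionEquiv_iff _ hLs hL u 1 huu (one_mul 1)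
  refine ⟨g.trans (normTwoReflectionEquiv hLs u 1 huu (one_mul 1)),
    LinearMap.BilinForm.IsometryEquiv.isOrientationPreserving_trans_of_not_of_not hLs hL hgo (by rw [hσ]; norm_num), ?_, ?_⟩
  · simp only [LinearMap.BilinForm.IsometryEquiv.discriminantGroupCongr_trans, LinearEquiv.trans_apply,
      discriminantGroupCongr_normTwoReflectionEquiv _ hLs u (Or.inl rfl) huu (one_mul 1), LinearEquiv.refl_apply]
    exact hg
  · rw [LinearMap.BilinForm.IsometryEquiv.trans_apply, hgh, normTwoReflectionEquiv_apply, huh, mul_zero, zero_smul, sub_zero]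

end Literature.AlgebraicGeometry.Hyperkaehler

end
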